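import Summits.QuantumFields.BalabanUV.T4Continuum.Support.ShellMeasureRootCompositionLevelZero
import Summits.QuantumFields.BalabanUV.T4Continuum.Support.ShellMeasureRayWiring

/-!
# `T4Continuum.ShellMeasureRayWiringEnd` — SM-L4 WIRING, file 2: the one-depth assembly and END-II (cube form) with
# the non-Wilson binder `hE`∕`hB𝓔` REPLACED by per-term analyticity–oscillation pairs along the chart ray
# (cell `pub-balaban`, sub-cell `t4`, spine estimate NE7c (node U5b); ROUND-2 crew row S16, seat
# `b2b-balaban-t4-ne7c-formalise-leaf-05`; ADDITIVE — imports `ShellMeasureRootCompositionLevelZero` (the cube form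
# of END-II, crew row S11) and `ShellMeasureRayWiring` (file 1, p208639) and modifies nothing)

HONEST FRAMING.  Finite four-torus programme, rung (B)+1 only — NOT infinite volume, NOT a mass gap, NOT the Clay
problem, NOT summit progress; (B), `BetaPertHyp`, (B^μ) not consumed.  NE7c is NOT PRINTED and NOT proved; the cell
wall (M1) is NOT moved.  This file is kernel plumbing only (two re-exports), 0 sorry, 0 citations; no `def … : Prop`;
nothing of Bałaban's terms is instantiated.  HONEST DEPENDENCY (cell): continuum YM on T⁴ ⇐ BetaPertH ∧ nine spine
estimates (0/9 proved); BetaPertH ⇐ (D1) ∧ (D4) ∧ CAP+tail; G-an2-4 gates asym, D1 and NE2/3/4.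

THE POINT.  The SM-L4 binder of the one-depth assembly `ShellMeasureLevelAssembly.slotAntiConcentration_of_levelData`
and of END-II is ONE opaque ray inequality `hE : 𝓔 (c • x) ≤ 𝓔 x + (1 − c)·B_𝓔` (+ `0 ≤ B_𝓔`).  The crew-row-S6
locator (GAPS G-ne7cL05-1) found that print displays, toward it, PER-TERM analyticity–boundedness pairs of the
localized pieces on their complex domains ([Balaban1987RG1] (1.18); [Balaban1988Convergent] (2.31), (2.42)) and the
composite analyticity through the localized minimiser along a one-parameter complexified perturbation ([Balaban1987RG1]
Lemma 4 (3.53), used as the disc bound (3.54)) — not the pair for the SUM; file 1 (`ShellMeasureRayWiring`) turned that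
reading into the kernel lemma `rayBound_of_analytic_terms`.  Here the two consumers are RE-EXPORTED with the SM-L4
group in per-term form — a common radius `RE > 1` (window units), per window point a finite family of holomorphic terms
`gE · x i` on `‖w‖ < RE` with oscillation bounds `HE · x i` summing to `≤ Hbar`, and the dictionary «the real part of
their sum along `[0,1]` IS `𝓔 (c • x)`» — everything else VERBATIM:
* §1 `slotAntiConcentration_of_levelData_rayTerms` — the chart-abstract assembly (any findim real chart `E`, any
  complete normed `ℂ`-algebra `A`), constant `2(dim E + β Σ_p L̄_p(d̄_p + 4s̄_p) + 3·Hbar/(RE − 1))/(1 − δ)`;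
* §2 `slotAC_realized_su2_of_levelData_cube_rayTerms` — END-II in the CUBE form of crew row S11
  (`ShellMeasureRootCompositionLevelZero.slotAC_realized_su2_of_levelData_cube`, the form the owner asked every consumer
  to target, CLAIMS l.6163 (1)), per exterior section `V`, same constant with `n = 3·#Λ`.
So after S4 (`hAN`∕`hGW` from per-bond data), S15 (`hFw` from box co-tests) and this file (`hE`∕`hB𝓔` from per-term
pairs), every ANALYTIC binder of END-II is a family of analyticity–boundedness pairs of printed TYPE; the located,
NOT-PRINTED content is unchanged: the radius in window units (READING) and the oscillation sum `Hbar` (NOT PRINTED as a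
number) — G-ne7cL05-1 (i)/(ii).  Nothing is discharged.

WHAT THIS DOES NOT DO.  No instance for Bałaban's `𝐄 ∕ 𝐑 ∕ 𝐁` terms or the `T_k` operations; SM-L1/L2/L3/L5/L6 keep
their status; NE7c NOT proved; 0/9 spine.
-/

noncomputable section

open NormedSpace Set Function MeasureTheory Metric

namespace Summit.QuantumFields.BalabanUV.T4Continuum.ShellMeasureRayWiringEnd

open scoped ENNReal
open Literature.MathematicalPhysics.QuantumFieldTheory.Balaban1983to89
open GaugeField (GaugeInvariant)
open T4ShellMeasure (SlotAntiConcentration)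
open T4CubePoincare (cube)
open T4CubeChartGnomonic (SU2)
open T4CubeChartExp (expWindowDensity expFibreChart)
open T4ShellMeasureDet (blockLaw)
open T4TreeGaugeFixing (NoClosedLoop fixTo)
open ShellMeasureWilsonTrace (TraceData)
open ShellMeasureWilsonMoving (MLetter mwordEval mdFro sSum lSum)
open ShellMeasureLevelAssembly (classifier weight slotAntiConcentration_of_levelData)
open ShellMeasureRootCompositionLevelZero (slotAC_realized_su2_of_levelData_cube)
open ShellMeasureRayWiring (rayBound_of_analytic_terms rayConst_nonneg)

/-! ## §1 The one-depth assembly with the SM-L4 group in per-term form -/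

section Assembly

variable {E : Type*} [NormedAddCommGroup E] [NormedSpace ℝ E] [MeasurableSpace E] [BorelSpace E]
  [FiniteDimensional ℝ E] (μ : Measure E) [μ.IsAddHaarMeasure]
variable {A : Type*} [NormedRing A] [NormedAlgebra ℂ A] [CompleteSpace A] [NormOneClass A]

/-- **(M1) AT ANY LEVEL FROM LEVEL DATA, SM-L4 IN PER-TERM FORM.**  `ShellMeasureLevelAssembly.slotAntiConcentration_of_levelData`
with its binder pair `hE`∕`hB𝓔` REPLACED by: a radius `1 < RE`, `0 ≤ Hbar`, and for every window point `x ∈ W` a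
finite family `gE x i`, `i ∈ IE x`, of functions holomorphic on `‖w‖ < RE` with `‖gE x i w − gE x i 0‖ ≤ HE x i` there,
`Σ_{i ∈ IE x} HE x i ≤ Hbar`, and `Re Σ_i gE x i c = 𝓔 (c • x)` on `c ∈ [0,1]` (`ShellMeasureRayWiring.rayBound_of_analytic_terms`
supplies `hE` with `B_𝓔 = 3·Hbar/(RE − 1)`).  Every other binder VERBATIM.  CONCLUSION:
`SlotAntiConcentration (μ.withDensity (J·e^{−S})) u θ ρ (2(dim E + β Σ_p L̄_p(d̄_p + 4s̄_p) + 3·Hbar/(RE − 1))/(1 − δ))`.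
[folklore] -/
theorem slotAntiConcentration_of_levelData_rayTerms (T : TraceData A) (hN : 0 < T.N)
    {ι κ : Type*} {Pu : Finset ι} (hPu : Pu.Nonempty) (hol : ι → E → A) (hcont : ∀ p ∈ Pu, Continuous (hol p))
    (Pw : Finset κ) (G : κ → E → A) (𝓔 : E → ℝ) {W : Set E} {J : E → ℝ≥0∞}
    {θ δ ρ β R H : ℝ} {sw lw dw : κ → ℝ}
    (hJW : ∀ x, J x ≠ 0 → x ∈ W) (hJ : ∀ x, ∀ a : ℝ, 0 ≤ a → J x ≤ J (Real.exp (-a) • x))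
    -- (AN-bound) for the classifier plaquettes
    (hR : 1 < R)
    (hAN : ∀ x ∈ W, ∀ p ∈ Pu, ∃ f : ℂ → A, DifferentiableOn ℂ f (ball 0 R) ∧ (∀ w ∈ ball (0 : ℂ) R, ‖f w‖ ≤ H) ∧
      f 0 = 0 ∧ ∀ c : ℝ, 0 ≤ c → c ≤ 1 → f (c : ℂ) = hol p (c • x) - 1)
    -- graded sectioned words for the weight plaquettes
    (hGW : ∀ x ∈ W, ∀ p ∈ Pw, ∃ gw : List (MLetter A × ℝ × ℝ), (∀ y ∈ gw, y.1.Good T.τ y.2.1 y.2.2) ∧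
      sSum gw ≤ sw p ∧ lSum gw ≤ lw p ∧ mdFro (gw.map Prod.fst) ≤ dw p ∧
      ∀ c : ℝ, 0 ≤ c → c ≤ 1 → mwordEval c (gw.map Prod.fst) = G p (c • x))
    (hsw1 : ∀ p ∈ Pw, sw p ≤ 1) (hsw0 : ∀ p ∈ Pw, 0 ≤ sw p) (hlw0 : ∀ p ∈ Pw, 0 ≤ lw p)
    (hdw0 : ∀ p ∈ Pw, 0 ≤ dw p)
    -- SM-L4 in per-term form: the non-Wilson part along the ray is the real part of a finite sum of holomorphic terms
    {ιE : Type*} (IE : E → Finset ιE) {gE : E → ιE → ℂ → ℂ} {RE : ℝ} {HE : E → ιE → ℝ} {Hbar : ℝ}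
    (hRE : 1 < RE) (hHbar : 0 ≤ Hbar)
    (hgE : ∀ x ∈ W, ∀ i ∈ IE x, DifferentiableOn ℂ (gE x i) (ball 0 RE))
    (hoscE : ∀ x ∈ W, ∀ i ∈ IE x, ∀ w ∈ ball (0 : ℂ) RE, ‖gE x i w - gE x i 0‖ ≤ HE x i)
    (hsumE : ∀ x ∈ W, ∑ i ∈ IE x, HE x i ≤ Hbar)
    (hrealE : ∀ x ∈ W, ∀ c : ℝ, 0 ≤ c → c ≤ 1 → (∑ i ∈ IE x, gE x i (c : ℂ)).re = 𝓔 (c • x))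
    -- numbers
    (hθ : 0 < θ) (hδ0 : 0 ≤ δ) (hδ1 : δ < 1) (hρ0 : 0 ≤ ρ) (hρ : ρ ≤ (1 - δ) / 2) (hβ : 0 ≤ β)
    (hSM : 36 * H * 1 ^ 2 / (R - 1) ^ 2 ≤ δ * θ)
    (hfin : (μ.withDensity fun x => J x * weight T β Pw G 𝓔 x) {x | classifier hPu hol x < θ} ≠ ∞) :
    SlotAntiConcentration (μ.withDensity fun x => J x * weight T β Pw G 𝓔 x) (classifier hPu hol) θ ρ
      (2 * (Module.finrank ℝ E + (β * ∑ p ∈ Pw, lw p * (dw p + 4 * sw p) + 3 * Hbar / (RE - 1))) / (1 - δ)) :=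
  slotAntiConcentration_of_levelData μ T hN hPu hol hcont Pw G 𝓔 hJW hJ hR hAN hGW hsw1 hsw0 hlw0 hdw0
    (rayBound_of_analytic_terms IE hRE hgE hoscE hsumE hrealE) (rayConst_nonneg hRE hHbar)
    hθ hδ0 hδ1 hρ0 hρ hβ hSM hfin

end Assembly

/-! ## §2 END-II (cube form) with the SM-L4 group in per-term form -/

section EndTwo

variable {P : Params} {j : ℕ} [DecidableEq (PBond P j)]
variable {A : Type*} [NormedRing A] [NormedAlgebra ℂ A] [CompleteSpace A] [NormOneClass A]

/-- **END-II (CUBE FORM) WITH SM-L4 IN PER-TERM FORM.**  `ShellMeasureRootCompositionLevelZero.slotAC_realized_su2_of_levelData_cube`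
(END-II with the dictionary asked on the chart cube — the form every consumer targets) with the binder pair
`hE`∕`hB𝓔` REPLACED, per exterior section `V`, by a common radius `1 < RE`, `0 ≤ Hbar`, and for every window point
`x ∈ W V` a finite family `gE V x i`, `i ∈ IE V x`, holomorphic on `‖w‖ < RE` with oscillation bounds `HE V x i` summing
to `≤ Hbar` and `Re Σ_i gE V x i c = 𝓔 V (c • x)` on `[0,1]`.  Every other binder VERBATIM (tree gauge `T`, `U₀`, chart
bonds `Λ` with enumeration `e`, window `S`, centres `c`, block weights `R`, density `F` with `hFw`∕`hfin`, tested variable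
`u`; level data `Ttr`, `hol`, `G`, `𝓔`, `W`, `Jco`; dictionary `hRdict`∕`hudict` on the cube; SM-L5/L6 `hJW`∕`hJ`;
SM-L1 `hRad`∕`hAN`; SM-L3 `hGW` + sizes; SM-L2 `hSM`; numbers).  CONCLUSION:
`SlotAntiConcentration ((fieldMeasure P j SU2).withDensity F) u θ ρ (2(n + β Σ_p L̄_p(d̄_p + 4s̄_p) + 3·Hbar/(RE − 1))/(1 − δ))`
— END-I's `hac` for this slot.  CONDITIONAL on every binder; the per-term data are of printed TYPE, NOT instantiated
(GAPS G-ne7cL05-1); nothing PRINTED is asserted. [folklore] -/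
theorem slotAC_realized_su2_of_levelData_cube_rayTerms {T : Finset (PBond P j)} (hT : NoClosedLoop T)
    (U₀ : GaugeField P j SU2) (Λ : Finset (PBond P j)) {n : ℕ} (e : ↥Λ × Fin 3 ≃ Fin n)
    {S : ℝ} (hS : 0 < S) (hSπ : 3 * S ^ 2 < Real.pi ^ 2) (c : GaugeField P j SU2 → GaugeField P j SU2)
    {R : GaugeField P j SU2 → (↥Λ → SU2) → ℝ≥0∞} (hR : ∀ V, Measurable (R V))
    {F : GaugeField P j SU2 → ℝ≥0∞} (hF : Measurable F) (hFi : GaugeInvariant F)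
    (hFw : ∀ V y, F (fixTo T U₀ (updateFinset V Λ y)) =
      ENNReal.ofReal (expWindowDensity Λ (c V) S (updateFinset (c V) Λ y)) * R V y)
    (hfin : ∀ V, ((blockLaw Λ).withDensity fun y => F (fixTo T U₀ (updateFinset V Λ y))) univ ≠ ∞)
    {u : GaugeField P j SU2 → ℝ} (hu : Measurable u) (hui : GaugeInvariant u)
    -- level data per exterior section
    (Ttr : TraceData A) (hN : 0 < Ttr.N) {ι κ : Type*} {Pu : Finset ι} (hPu : Pu.Nonempty)
    (hol : GaugeField P j SU2 → ι → (Fin n → ℝ) → A) (hcont : ∀ V, ∀ p ∈ Pu, Continuous (hol V p))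
    (Pw : Finset κ) (G : GaugeField P j SU2 → κ → (Fin n → ℝ) → A) (𝓔 : GaugeField P j SU2 → (Fin n → ℝ) → ℝ)
    (W : GaugeField P j SU2 → Set (Fin n → ℝ)) (Jco : GaugeField P j SU2 → (Fin n → ℝ) → ℝ≥0∞)
    {θ δ ρ β Rad H : ℝ} {sw lw dw : κ → ℝ}
    -- DICTIONARY (on the chart cube)
    (hRdict : ∀ V, ∀ x ∈ cube n S,
      R V (expFibreChart Λ (c V) e x) = Jco V x * weight Ttr β Pw (G V) (𝓔 V) x)
    (hudict : ∀ V, ∀ x ∈ cube n S,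
      u (fixTo T U₀ (updateFinset V Λ (expFibreChart Λ (c V) e x))) = classifier hPu (hol V) x)
    -- SM-L5/L6: kept co-tests supported in the window, centre-monotone
    (hJW : ∀ V x, Jco V x ≠ 0 → x ∈ W V)
    (hJ : ∀ V x, ∀ a : ℝ, 0 ≤ a → Jco V x ≤ Jco V (Real.exp (-a) • x))
    -- SM-L1 (AN-bound)
    (hRad : 1 < Rad)
    (hAN : ∀ V, ∀ x ∈ W V, ∀ p ∈ Pu, ∃ f : ℂ → A, DifferentiableOn ℂ f (ball 0 Rad) ∧
      (∀ w ∈ ball (0 : ℂ) Rad, ‖f w‖ ≤ H) ∧ f 0 = 0 ∧ ∀ c' : ℝ, 0 ≤ c' → c' ≤ 1 → f (c' : ℂ) = hol V p (c' • x) - 1)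
    -- SM-L3 graded sectioned words
    (hGW : ∀ V, ∀ x ∈ W V, ∀ p ∈ Pw, ∃ gw : List (MLetter A × ℝ × ℝ), (∀ y ∈ gw, y.1.Good Ttr.τ y.2.1 y.2.2) ∧
      sSum gw ≤ sw p ∧ lSum gw ≤ lw p ∧ mdFro (gw.map Prod.fst) ≤ dw p ∧
      ∀ c' : ℝ, 0 ≤ c' → c' ≤ 1 → mwordEval c' (gw.map Prod.fst) = G V p (c' • x))
    (hsw1 : ∀ p ∈ Pw, sw p ≤ 1) (hsw0 : ∀ p ∈ Pw, 0 ≤ sw p) (hlw0 : ∀ p ∈ Pw, 0 ≤ lw p)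
    (hdw0 : ∀ p ∈ Pw, 0 ≤ dw p)
    -- SM-L4 in per-term form
    {ιE : Type*} (IE : GaugeField P j SU2 → (Fin n → ℝ) → Finset ιE)
    {gE : GaugeField P j SU2 → (Fin n → ℝ) → ιE → ℂ → ℂ} {RE : ℝ}
    {HE : GaugeField P j SU2 → (Fin n → ℝ) → ιE → ℝ} {Hbar : ℝ}
    (hRE : 1 < RE) (hHbar : 0 ≤ Hbar)
    (hgE : ∀ V, ∀ x ∈ W V, ∀ i ∈ IE V x, DifferentiableOn ℂ (gE V x i) (ball 0 RE))
    (hoscE : ∀ V, ∀ x ∈ W V, ∀ i ∈ IE V x, ∀ w ∈ ball (0 : ℂ) RE, ‖gE V x i w - gE V x i 0‖ ≤ HE V x i)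
    (hsumE : ∀ V, ∀ x ∈ W V, ∑ i ∈ IE V x, HE V x i ≤ Hbar)
    (hrealE : ∀ V, ∀ x ∈ W V, ∀ c' : ℝ, 0 ≤ c' → c' ≤ 1 → (∑ i ∈ IE V x, gE V x i (c' : ℂ)).re = 𝓔 V (c' • x))
    -- numbers + SM-L2 (SM)
    (hθ : 0 < θ) (hδ0 : 0 ≤ δ) (hδ1 : δ < 1) (hρ0 : 0 ≤ ρ) (hρ : ρ ≤ (1 - δ) / 2) (hβ : 0 ≤ β)
    (hSM : 36 * H * 1 ^ 2 / (Rad - 1) ^ 2 ≤ δ * θ) :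
    SlotAntiConcentration ((fieldMeasure P j SU2).withDensity F) u θ ρ
      (2 * ((n : ℝ) + (β * ∑ p ∈ Pw, lw p * (dw p + 4 * sw p) + 3 * Hbar / (RE - 1))) / (1 - δ)) :=
  slotAC_realized_su2_of_levelData_cube hT U₀ Λ e hS hSπ c hR hF hFi hFw hfin hu hui Ttr hN hPu hol hcont Pw G 𝓔 W
    Jco hRdict hudict hJW hJ hRad hAN hGW hsw1 hsw0 hlw0 hdw0
    (fun V => rayBound_of_analytic_terms (IE V) hRE (hgE V) (hoscE V) (hsumE V) (hrealE V))
    (rayConst_nonneg hRE hHbar) hθ hδ0 hδ1 hρ0 hρ hβ hSM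

end EndTwo

end Summit.QuantumFields.BalabanUV.T4Continuum.ShellMeasureRayWiringEnd

end
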